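import Summits.AtomisticToContinuum.Crystallization.Theorems.FrustratedLawDichotomyStrainedPatchStiffDoorA

/-!
# lens-5 NODE «StiffDoor» — part 2 of 2 (sequel of `…FrustratedLawDichotomyStrainedPatchStiffDoorA`)

Split for the 400-line cap by the landing lane (hand-2 g41); the module docstring of part 1 (`…FrustratedLawDichotomyStrainedPatchStiffDoorA`) describes the whole node.  Same namespace; all FQNs unchanged.
0 sorry; standard axioms.
-/

open scoped BigOperators Classical RealInnerProductSpace
open Summit.AtomisticToContinuum.Crystallization.Theorems.ChargedEnergyGapNegative (eStar E3)
open Summit.AtomisticToContinuum.Crystallization.Theorems.FrustratedLawDichotomyRangeCut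
open Summit.AtomisticToContinuum.Crystallization.Theorems.FrustratedLawDichotomySchurCut
open Summit.AtomisticToContinuum.Crystallization.Theorems.FrustratedLawDichotomyMotifLemmas (GoodAtScale)
open Summit.AtomisticToContinuum.Crystallization.Theorems.FrustratedLawDichotomyAveragingCut (ballAvg)
open Summit.AtomisticToContinuum.Crystallization.Theorems.FrustratedLawDichotomyExemptLocOpt (LocOptFails)
open Summit.AtomisticToContinuum.Crystallization.Theorems.FrustratedLawDichotomyExemptSplit (SchurElasticPricingX)
open Summit.AtomisticToContinuum.Crystallization.Theorems.FrustratedLawDichotomyExemptAbsorptionRecord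
open Summit.AtomisticToContinuum.Crystallization.Theorems.FrustratedLawDichotomyCollarCensus
open Summit.AtomisticToContinuum.Crystallization.Theorems.FrustratedLawDichotomyCollarCensusKappa
open Summit.AtomisticToContinuum.Crystallization.Theorems.FrustratedLawDichotomyStrainedPatchHomSplit
open Summit.AtomisticToContinuum.Crystallization.Theorems.FrustratedLawDichotomyStrainedPatchCleanCollar (CleanBall TailPenalty AnnularDefectFloor
  DefectiveCollarFloor tailOut)
open Summit.AtomisticToContinuum.Crystallization.Theorems.FrustratedLawDichotomyStrainedPatchPhaseCut (MonoPhaseBall AnnularPhaseFloor PolyTextureFloor)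
open Summit.AtomisticToContinuum.Crystallization.Theorems.FrustratedLawDichotomyStrainedPatchCoreTube (NearHomIsoAt CoreOffTubeFloor)
open Summit.AtomisticToContinuum.Crystallization.Theorems.FrustratedLawDichotomyStrainedPatchCoreTubeRecord (CoreCoreRelief)
open Summit.AtomisticToContinuum.Crystallization.Theorems.FrustratedLawDichotomyStrainedPatchChartFamilies (ChartBy FamilyLE familyLE_refl)
open Summit.AtomisticToContinuum.Crystallization.Theorems.FrustratedLawDichotomyStrainedPatchQuantSlaving (ChartFam SlackTab HessTab ForceTab hessBlk0)
open Summit.AtomisticToContinuum.Crystallization.Theorems.FrustratedLawDichotomyStrainedPatchHostCells (TubeFloor)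
open Summit.AtomisticToContinuum.Crystallization.Theorems.FrustratedLawDichotomyStrainedPatchGradedTube
open Summit.AtomisticToContinuum.Crystallization.Theorems.FrustratedLawDichotomyStrainedPatchCoverBridge
open Summit.AtomisticToContinuum.Crystallization.Theorems.FrustratedLawDichotomyStrainedPatchPairTube
open Summit.AtomisticToContinuum.Crystallization.Theorems.FrustratedLawDichotomyStrainedPatchHomCertTree (CertTree treeOK)
open Summit.AtomisticToContinuum.Crystallization.Theorems.FrustratedLawDichotomyStrainedPatchHomEntryGram (rootC rootW)
open Summit.AtomisticToContinuum.Crystallization.Theorems.FrustratedLawDichotomyStrainedPatchHomEntryGramHcp (rootCH rootWH)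
open Summit.AtomisticToContinuum.Crystallization.Theorems.FrustratedLawDichotomyStrainedPatchHomEntryLeafHT (entryLeafOK6RBKP4 semOKH)
open Summit.AtomisticToContinuum.Crystallization.Theorems.FrustratedLawDichotomyAperiodicGapRecordJunctionHomFloorF6pT26
open Summit.AtomisticToContinuum.Crystallization.Theorems.FrustratedLawDichotomyStrainedPatchConeAnatomy
open Summit.AtomisticToContinuum.Crystallization.Theorems.FrustratedLawDichotomyStrainedPatchStiffSector

namespace Summit.AtomisticToContinuum.Crystallization.Theorems.FrustratedLawDichotomyStrainedPatchStiffDoor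

/-! ## §2. The cluster-side sector cut of (N) at ONE common table; the three-sector cut of record -/

section Cut

variable {𝓘₀ 𝓗 𝓟 : ChartFam} {ρ ε η₂ τ₀ τ : ℝ} {T₀ T : SlackTab} {B : PairTab}

/-- ★ TWO SECTORS, ONE TABLE: (N) over the coarse family is the conjunction of its restrictions to the clusters charted by `𝓟`-hosts and by `¬𝓟`-hosts — the
table is read at the HULL host, so no matching of sectors between coarse and hull host is needed. [formal bookkeeping] -/
theorem refineGB_of_two_sectors (h₁ : RefineGB (famAnd 𝓘₀ 𝓟) 𝓗 ρ ε η₂ τ₀ T₀ τ T B) (h₂ : RefineGB (famAndNot 𝓘₀ 𝓟) 𝓗 ρ ε η₂ τ₀ T₀ τ T B) :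
    RefineGB 𝓘₀ 𝓗 ρ ε η₂ τ₀ T₀ τ T B := by
  intro M z c M₀ z₀ c₀ e hz hcl hm hn hg hch
  by_cases hP : 𝓟 M₀ z₀ c₀
  · exact h₁ M z c M₀ z₀ c₀ e hz hcl hm hn hg (chartByG_refamily hch ⟨chartByG_mem hch, hP⟩)
  · exact h₂ M z c M₀ z₀ c₀ e hz hcl hm hn hg (chartByG_refamily hch ⟨chartByG_mem hch, hP⟩)

/-- EXACTNESS, off-sector half (the on-sector half is g94's `refineGB_famAnd_of_refineGB`). [formal bookkeeping] -/
theorem refineGB_famAndNot_of_refineGB (h : RefineGB 𝓘₀ 𝓗 ρ ε η₂ τ₀ T₀ τ T B) : RefineGB (famAndNot 𝓘₀ 𝓟) 𝓗 ρ ε η₂ τ₀ T₀ τ T B :=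
  fun M z c M₀ z₀ c₀ e hz hcl hm hn hg hch => h M z c M₀ z₀ c₀ e hz hcl hm hn hg (hch.mono_family famAndNot_le)

/-- ★ (N) ⟺ (N|𝓟) ∧ (N|¬𝓟) at a common table — every piece STRICTLY WEAKER than (N), jointly equivalent. [formal bookkeeping] -/
theorem refineGB_iff_two_sectors :
    RefineGB 𝓘₀ 𝓗 ρ ε η₂ τ₀ T₀ τ T B ↔ RefineGB (famAnd 𝓘₀ 𝓟) 𝓗 ρ ε η₂ τ₀ T₀ τ T B ∧ RefineGB (famAndNot 𝓘₀ 𝓟) 𝓗 ρ ε η₂ τ₀ T₀ τ T B :=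
  ⟨fun h => ⟨refineGB_famAnd_of_refineGB h, refineGB_famAndNot_of_refineGB h⟩, fun h => refineGB_of_two_sectors h.1 h.2⟩

/-- ★★ **THE THREE-SECTOR CUT** (𝔇 = dense ∧ `𝓡`, 𝔅 = dense ∧ `¬𝓡`, 𝔄 = dilated): (N|𝔇)(B) ∧ (N|𝔅)(B) at ONE dense-side table `B` (host-graded: record
cones on `𝓡`-hosts, wide cones off them), dilated coarse hosts hull hosts, `B` capped by the site sums ⟹ (N) at `sectorPair (Dense dA) B T` — the dilated
piece is g94's free one. [folklore] -/
theorem refineGB_threeSector {dA : ℝ} {𝓡 : ChartFam} (hD : RefineGB (famAnd (famAnd 𝓘₀ (Dense dA)) 𝓡) 𝓗 ρ ε η₂ τ₀ T₀ τ T B)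
    (hB : RefineGB (famAndNot (famAnd 𝓘₀ (Dense dA)) 𝓡) 𝓗 ρ ε η₂ τ₀ T₀ τ T B) (h𝓗 : FamilyLE (famAndNot 𝓘₀ (Dense dA)) 𝓗) (hτ : τ₀ ≤ τ)
    (hT : TolLE T₀ T) (hBT : PairLE B (pairSum T)) : RefineGB 𝓘₀ 𝓗 ρ ε η₂ τ₀ T₀ τ T (sectorPair (Dense dA) B T) :=
  refineGB_of_stiffSector (refineGB_of_two_sectors hD hB) h𝓗 hτ hT hBT

end Cut

/-! ## §3. The sector table IS the record's host-graded cone (dense: the functional; dilated: kinematic) -/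

section Table

/-- The sector table over a `relConeBy` cone at the constant site table is ITSELF a `relConeBy` cone with STEP functionals (`2τ₀`, slope `0` off the
sector — the kinematic value). [formal bookkeeping] -/
theorem sectorPair_relConeBy (𝓟 : ChartFam) (RE τ₀ : ℝ) (βf sf : (M₀ : ℕ) → (Fin M₀ → E3) → Fin M₀ → ℝ) :
    sectorPair 𝓟 (relConeBy RE βf sf τ₀) (constTol τ₀) = relConeBy RE (stepByF 𝓟 βf fun _ _ _ => 2 * τ₀) (stepByF 𝓟 sf fun _ _ _ => 0) τ₀ := by
  funext M₀ z₀ c₀ a b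
  by_cases hp : 𝓟 M₀ z₀ c₀
  · rw [sectorPair_of_pos hp]
    simp only [relConeBy, stepByF_of_pos hp]
  · rw [sectorPair_of_neg hp]
    simp only [relConeBy, stepByF_of_neg hp, pairSum, constTol_apply]
    unfold relCone
    split_ifs <;> ring

/-- … record instance (`RE = 2`, `τ₀ = 1/25`, kinematic floor `2/25`). [formal bookkeeping] -/
theorem sectorPair_relConeBy_record (𝓟 : ChartFam) (βf sf : (M₀ : ℕ) → (Fin M₀ → E3) → Fin M₀ → ℝ) :
    sectorPair 𝓟 (relConeBy 2 βf sf (1 / 25)) (constTol (1 / 25)) =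
      relConeBy 2 (stepByF 𝓟 βf fun _ _ _ => 2 / 25) (stepByF 𝓟 sf fun _ _ _ => 0) (1 / 25) := by
  funext M₀ z₀ c₀ a b
  by_cases hp : 𝓟 M₀ z₀ c₀
  · rw [sectorPair_of_pos hp]
    simp only [relConeBy, stepByF_of_pos hp]
  · rw [sectorPair_of_neg hp]
    simp only [relConeBy, stepByF_of_neg hp, pairSum, constTol_apply]
    unfold relCone
    split_ifs <;> norm_num

/-- The KINEMATIC cone (`β = 2τ₀`, slope `0`) IS the pair-blind site-sum table. [formal bookkeeping] -/
theorem relCone_kinematic (RE τ₀ : ℝ) : relCone RE (2 * τ₀) 0 τ₀ = pairSum (constTol τ₀) := by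
  funext M₀ z₀ c₀ a b
  simp only [pairSum, constTol_apply]
  unfold relCone
  split_ifs <;> ring

/-- … record instance. [formal bookkeeping] -/
theorem relCone_kinematic_record : relCone 2 (2 / 25) 0 (1 / 25) = pairSum (constTol (1 / 25)) := by
  funext M₀ z₀ c₀ a b
  simp only [pairSum, constTol_apply]
  unfold relCone
  split_ifs <;> norm_num

end Table

/-! ## §4. The record readings of the three-sector cut: (D_GB⋆ by host) -/

section Record

variable {𝓘₀ 𝓗 𝓘 𝓡 : ChartFam} {ρ ε τ dA : ℝ} {T : SlackTab} {βf sf : (M₀ : ℕ) → (Fin M₀ → E3) → Fin M₀ → ℝ}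

/-- ★★★ **(D_GB⋆ by host at ρ, ε) from the three sectors, hull family INSIDE the E-cell family** (`𝓗 ≤ 𝓘`: (F) of 87C discharged by monotonicity — at record data
both sides the shadow is the identity).  The glued functionals: `βf` / `sf` on dense hosts (themselves `stepByF 𝓡 …` between record and wide cones), the
kinematic `2/25` / `0` on dilated hosts. [folklore] -/
theorem refineGBRecByAt_threeSector
    (hD : RefineGB (famAnd (famAnd 𝓘₀ (Dense dA)) 𝓡) 𝓗 ρ ε (1 / 8) (1 / 25) (constTol (1 / 25)) (1 / 25) (constTol (1 / 25)) (relConeBy 2 βf sf (1 / 25)))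
    (hB : RefineGB (famAndNot (famAnd 𝓘₀ (Dense dA)) 𝓡) 𝓗 ρ ε (1 / 8) (1 / 25) (constTol (1 / 25)) (1 / 25) (constTol (1 / 25)) (relConeBy 2 βf sf (1 / 25)))
    (h𝓗 : FamilyLE (famAndNot 𝓘₀ (Dense dA)) 𝓗) (hcap : PairLE (relConeBy 2 βf sf (1 / 25)) (pairSum (constTol (1 / 25)))) (h𝓘 : FamilyLE 𝓗 𝓘) :
    RefineGBRecByAt 𝓘₀ 𝓘 ρ ε (stepByF (Dense dA) βf fun _ _ _ => 2 / 25) (stepByF (Dense dA) sf fun _ _ _ => 0) := by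
  have h := refineGB_threeSector hD hB h𝓗 le_rfl (TolLE.refl _) hcap
  rw [sectorPair_relConeBy_record] at h
  unfold RefineGBRecByAt
  exact h.mono h𝓘 (TolLE.refl _) (PairLE.refl _) le_rfl

/-- ★ … and the general record family through the GB-shadow (F) of 87C (hull data `(τ, T)` dominating the coarse data, g94's reading). [folklore] -/
theorem refineGBRecByAt_threeSector_of_shadows {B : PairTab} {βf' sf' : (M₀ : ℕ) → (Fin M₀ → E3) → Fin M₀ → ℝ}
    (hD : RefineGB (famAnd (famAnd 𝓘₀ (Dense dA)) 𝓡) 𝓗 ρ ε (1 / 8) (1 / 25) (constTol (1 / 25)) τ T B)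
    (hB : RefineGB (famAndNot (famAnd 𝓘₀ (Dense dA)) 𝓡) 𝓗 ρ ε (1 / 8) (1 / 25) (constTol (1 / 25)) τ T B)
    (h𝓗 : FamilyLE (famAndNot 𝓘₀ (Dense dA)) 𝓗) (hτ : 1 / 25 ≤ τ) (hT : TolLE (constTol (1 / 25)) T) (hBT : PairLE B (pairSum T))
    (hSh : ShadowsGB 𝓗 𝓘 τ (1 / 25) T (constTol (1 / 25)) (sectorPair (Dense dA) B T) (relConeBy 2 βf' sf' (1 / 25))) :
    RefineGBRecByAt 𝓘₀ 𝓘 ρ ε βf' sf' :=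
  refineGBRecByAt_of_stiffSector_of_shadows (refineGB_of_two_sectors hD hB) h𝓗 hτ hT hBT hSh

end Record

/-! ## §5. The E-side (critic (b)): the pair-blind cell of the dilated sector IS the scalar tube floor; the three E-cells of record -/

section Energy

variable {𝓘 𝓡 : ChartFam} {dA : ℝ} {βf βf₁ βf₂ sf sf₁ sf₂ : (M₀ : ℕ) → (Fin M₀ → E3) → Fin M₀ → ℝ}

/-- ★ **THE E-PRICING SPEC, typed**: at the kinematic cone the GB E-cell of ANY host class is LITERALLY the scalar `1/25` tube floor of that class (no pair
information).  «E-DIL-95» = this cell on the class `famAndNot 𝓘 (Dense (26/25))`; E-PRICE-95: decoupled margin `≥ +0.0116`/site there. [formal bookkeeping] -/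
theorem tubeFloorGB_kinematic_iff (𝓙 : ChartFam) : TubeFloorGB 𝓙 (1 / 25) (constTol (1 / 25)) (relCone 2 (2 / 25) 0 (1 / 25)) ↔ TubeFloor 𝓙 (1 / 25) := by
  rw [relCone_kinematic_record]
  exact tubeFloorGB_pairSum_iff.trans tubeFloorG_constTol_iff

/-- ★★ **THE THREE E-CELLS OF RECORD ⟹ (TF-GB⋆ by host)** at the glued functionals of `refineGBRecByAt_threeSector` (with `βf := stepByF 𝓡 βf₁ βf₂` there):
(E|𝔇) the record-cone boxes on `𝓡`-hosts, (E|𝔅) the wide-cone boxes on dense `¬𝓡`-hosts, (E|𝔄) the PAIR-BLIND scalar floor on dilated hosts. [folklore] -/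
theorem tubeFloorGBRecBy_threeSector (hD : TubeFloorGB (famAnd (famAnd 𝓘 (Dense dA)) 𝓡) (1 / 25) (constTol (1 / 25)) (relConeBy 2 βf₁ sf₁ (1 / 25)))
    (hB : TubeFloorGB (famAndNot (famAnd 𝓘 (Dense dA)) 𝓡) (1 / 25) (constTol (1 / 25)) (relConeBy 2 βf₂ sf₂ (1 / 25)))
    (hA : TubeFloor (famAndNot 𝓘 (Dense dA)) (1 / 25)) :
    TubeFloorGBRecBy 𝓘 (stepByF (Dense dA) (stepByF 𝓡 βf₁ βf₂) fun _ _ _ => 2 / 25) (stepByF (Dense dA) (stepByF 𝓡 sf₁ sf₂) fun _ _ _ => 0) := by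
  have hA' : TubeFloorGB (famAndNot 𝓘 (Dense dA)) (1 / 25) (constTol (1 / 25)) (relConeBy 2 (fun _ _ _ => 2 / 25) (fun _ _ _ => 0) (1 / 25)) := by
    rw [relConeBy_const]
    exact (tubeFloorGB_kinematic_iff _).2 hA
  unfold TubeFloorGBRecBy
  exact tubeFloorGB_relConeBy_stepF (tubeFloorGB_relConeBy_stepF hD hB) hA'

/-- ★ EXACTNESS of the E-pricing: the glued record E-cell GIVES BACK the pair-blind scalar floor on the dilated class — «E-DIL-95» is not a convenience but
exactly what the record asks of dilated hosts. [formal bookkeeping] -/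
theorem tubeFloor_dilated_of_recBy (h : TubeFloorGBRecBy 𝓘 (stepByF (Dense dA) βf fun _ _ _ => 2 / 25) (stepByF (Dense dA) sf fun _ _ _ => 0)) :
    TubeFloor (famAndNot 𝓘 (Dense dA)) (1 / 25) := by
  refine (tubeFloorGB_kinematic_iff _).1 fun M z c M₀ z₀ c₀ e hz hcl hm hch => ?_
  have hn : ¬Dense dA M₀ z₀ c₀ := (chartByG_mem hch.chartByG).2
  refine h M z c M₀ z₀ c₀ e hz hcl hm ((hch.mono_family famAndNot_le).congr_pair fun a b => ?_)
  simp only [relConeBy, stepByF_of_neg hn]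

/-- … and the dense-side cells likewise restrict from the glued cell (antitone in the family, table agreeing on the class). [formal bookkeeping] -/
theorem tubeFloorGB_dense_of_recBy (h : TubeFloorGBRecBy 𝓘 (stepByF (Dense dA) βf fun _ _ _ => 2 / 25) (stepByF (Dense dA) sf fun _ _ _ => 0)) :
    TubeFloorGB (famAnd 𝓘 (Dense dA)) (1 / 25) (constTol (1 / 25)) (relConeBy 2 βf sf (1 / 25)) := by
  intro M z c M₀ z₀ c₀ e hz hcl hm hch
  have hp : Dense dA M₀ z₀ c₀ := (chartByG_mem hch.chartByG).2
  refine h M z c M₀ z₀ c₀ e hz hcl hm ((hch.mono_family famAnd_le).congr_pair fun a b => ?_)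
  simp only [relConeBy, stepByF_of_pos hp]

end Energy

/-! ## §6. Kill targets by sector (the census's SHUFFLE witnesses are DILATED hosts: they refute nothing on 𝔇 or 𝔅; a BAND witness would) -/

section Witness

variable {𝓘₀ 𝓗 𝓡 : ChartFam} {ρ ε η₂ τ₀ τ dA : ℝ} {T₀ T : SlackTab} {B : PairTab} {M : ℕ} {z : Fin M → E3} {c : Fin M}

/-- A cone witness coarse-charted by a BAND host (dense, not `𝓡`) refutes (N|𝔅) at that table — the typed target «BAND-95-CERT» (a SHUFFLE-94-type cluster on a
host with `24/25 < d < 26/25`, `η` above the diagonal, at the record cones). [formal bookkeeping] -/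
theorem not_refineGB_band_of_coneWitness (h : ConeWitness (famAndNot (famAnd 𝓘₀ (Dense dA)) 𝓡) 𝓗 ρ ε η₂ τ₀ T₀ τ T B z c) :
    ¬RefineGB (famAndNot (famAnd 𝓘₀ (Dense dA)) 𝓡) 𝓗 ρ ε η₂ τ₀ T₀ τ T B :=
  not_refineGB_of_coneWitness h

/-- A cone witness coarse-charted by a DILATED host refutes NOTHING the cut asks: (N|𝔄) holds at the sector table whatever the witness (g94's free lemma) —
recorded as the implication «witness on 𝔄 ⟹ its table is not the sector table's dilated value». [formal bookkeeping] -/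
theorem coneWitness_dilated_not_sectorTable (h𝓗 : FamilyLE (famAndNot 𝓘₀ (Dense dA)) 𝓗) (hτ : τ₀ ≤ τ) (hT : TolLE T₀ T)
    (h : ConeWitness (famAndNot 𝓘₀ (Dense dA)) 𝓗 ρ ε η₂ τ₀ T₀ τ T (sectorPair (Dense dA) B T) z c) : False :=
  not_refineGB_of_coneWitness h (refineGB_famAndNot_free h𝓗 hτ hT)

end Witness

/-! ## §7. The crux BY NAME from the six sector cells (route (F₆′), (α)-switch literals T26/μ₇₄, `ρ = 26/5`) -/

section Crux

variable {𝓘₀ 𝓗 𝓘 𝓡 : ChartFam} {dA : ℝ} {βf₁ βf₂ sf₁ sf₂ : (M₀ : ℕ) → (Fin M₀ → E3) → Fin M₀ → ℝ}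

/-- ★★★ **`AperiodicFrustratedLawGap` from the three-sector cells**: the landed consumer `…fallbackLever_pairTube_A35000_T26_record` (p854049) with its E-leaf
`hTB` REPLACED by the three E-cells (`tubeFloorGBRecBy_threeSector`) and its T-leaf `hDf` REPLACED by (N|𝔇) ∧ (N|𝔅) + the dilated hull hosts + the cap + `𝓗 ≤ 𝓘`
(`refineGBRecByAt_threeSector`).  Dense-side table: `relConeBy 2 (stepByF 𝓡 βf₁ βf₂) (stepByF 𝓡 sf₁ sf₂) (1/25)`. [folklore instantiation] -/
theorem aperiodicFrustratedLawGap_of_threeSector_A35000_T26_record {εE CE DE DX : ℝ}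
    (hε0 : 0 < εE) (hε1 : εE ≤ 1 / 10000) (hDX : 0 ≤ DX)
    (hEl : SchurElasticPricingX (1 / 20) (1 / 8) w₄₅ ω₄ (3 / 400) (-(7175 / 10000)) (1 / 10000) CE DE DX (LocOptFails eStar εE (3 / 2) 1))
    (hFcc : ∃ t : CertTree (Fin 3 × Fin 3), treeOK (entryLeafOK6RBKP4 (-399210329969189)) t rootC rootW = true)
    (hHcp : semOKH (-399210329969189) rootCH rootWH = true)
    (hT : ∀ (M : ℕ) (z : Fin M → E3) (c : Fin M), Admissible M z c → CleanBall (63 / 10) z c → MonoPhaseBall (63 / 10) z c →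
      NearHomIsoAt (26 / 5) (1 / 100) z c → -(13 / 50000) ≤ ballAvg (9 / 5) z (tailOut (26 / 5) M z c) c)
    (hRl : CoreCoreRelief (63 / 10) (63 / 10) (26 / 5) (1 / 100) (3 / 5000))
    (hED : TubeFloorGB (famAnd (famAnd 𝓘 (Dense dA)) 𝓡) (1 / 25) (constTol (1 / 25)) (relConeBy 2 βf₁ sf₁ (1 / 25)))
    (hEB : TubeFloorGB (famAndNot (famAnd 𝓘 (Dense dA)) 𝓡) (1 / 25) (constTol (1 / 25)) (relConeBy 2 βf₂ sf₂ (1 / 25)))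
    (hEA : TubeFloor (famAndNot 𝓘 (Dense dA)) (1 / 25))
    (hK : FamilyCoverGRecAt 𝓘₀ (26 / 5) (1 / 100))
    (hND : RefineGB (famAnd (famAnd 𝓘₀ (Dense dA)) 𝓡) 𝓗 (26 / 5) (1 / 100) (1 / 8) (1 / 25) (constTol (1 / 25)) (1 / 25) (constTol (1 / 25))
      (relConeBy 2 (stepByF 𝓡 βf₁ βf₂) (stepByF 𝓡 sf₁ sf₂) (1 / 25)))
    (hNB : RefineGB (famAndNot (famAnd 𝓘₀ (Dense dA)) 𝓡) 𝓗 (26 / 5) (1 / 100) (1 / 8) (1 / 25) (constTol (1 / 25)) (1 / 25) (constTol (1 / 25))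
      (relConeBy 2 (stepByF 𝓡 βf₁ βf₂) (stepByF 𝓡 sf₁ sf₂) (1 / 25)))
    (h𝓗 : FamilyLE (famAndNot 𝓘₀ (Dense dA)) 𝓗) (hcap : PairLE (relConeBy 2 (stepByF 𝓡 βf₁ βf₂) (stepByF 𝓡 sf₁ sf₂) (1 / 25)) (pairSum (constTol (1 / 25))))
    (h𝓘 : FamilyLE 𝓗 𝓘)
    (hF : AnnularPhaseFloor (63 / 10) (24 / 5) (63 / 10) (1 / 1000)) (hP : PolyTextureFloor (63 / 10) (24 / 5) (1 / 1000))
    (hA : AnnularDefectFloor (24 / 5) (63 / 10)) (hD : DefectiveCollarFloor (24 / 5))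
    (h2 : CrowdedCoreMotifPricingCapK (1 / 1000) (9 / 5) (133 / 10) (3 / 2) (effPot w₄₅ ω₄ (3 / 400)) (-(7175 / 10000) + 3 / 400)
      (Collar (9 / 2) fun N y j => (∃ s : ℝ, 0 ≤ s ∧ s ≤ 3 / 2 ∧ NonEquilibriumCore (-(7175 / 10000)) 0 7 s (1 / 10000) N y j) ∨
        GoodAtScale (1 / 20) (3 / 2) y j))
    (h3 : DiluteDefectMotifPricingCapK (1 / 1000) (9 / 5) (133 / 10) (3 / 2) (effPot w₄₅ ω₄ (3 / 400)) (-(7175 / 10000) + 3 / 400)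
      (Collar (9 / 2) fun N y j => (∃ s : ℝ, 0 ≤ s ∧ s ≤ 3 / 2 ∧ NonEquilibriumCore (-(7175 / 10000)) 0 7 s (1 / 10000) N y j) ∨
        GoodAtScale (1 / 20) (3 / 2) y j)) :
    Summit.AtomisticToContinuum.Crystallization.Theses.FrustratedLawDichotomy.AperiodicFrustratedLawGap :=
  aperiodicFrustratedLawGap_of_entryTree6RBKP4_semOKH_fallbackLever_pairTube_A35000_T26_record hε0 hε1 hDX hEl hFcc hHcp hT hRl
    (tubeFloorGBRecBy_threeSector hED hEB hEA) hK (refineGBRecByAt_threeSector hND hNB h𝓗 hcap h𝓘) hF hP hA hD h2 h3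

end Crux

end Summit.AtomisticToContinuum.Crystallization.Theorems.FrustratedLawDichotomyStrainedPatchStiffDoor
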